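import Summits.HodgeConjecture.CorCM.Census.OddSliceFacesGenerate

/-!
# Faces generate the Hodge lattice of the faithful full odd slice, III: the count — the family has exactly one face per simple
# factor other than `E`

COR-CM (cell `pub-hodgecm2`), count-neutral kernel census by the binder seat b09 (gen 26; lane ODD-SLICE-FACES, part V of
`OddSliceFacesModel` → `OddSliceFacesSquares` → `OddSliceFacesDescent` → `OddSliceFacesGenerate` → `OddSliceFacesCount` →
`OddSliceFacesRecord`; §3 of gen 25's `Census/CyclicPrimeFacesGenerate.lean` with `ℤ/p` replaced by a finite abelian group `A` of odd
order).  Bookkeeping definition (`B1`) + theorems; no `decide` table, no certificate, no named fact, no geometry, no `sorry`.  HC_CM is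
not proved anywhere in this cell; nothing here is a headline and nothing here produces a period.

CONTENT.  `sqFace` is injective on simple factors (the normalised representative determines the factor, `mk_rep`); the closing face
is not a canonical square (its first place is not a defect of its type, `sStar_fst_apply`); for `|A| > 1` exactly one simple factor
has defect class `< 2`, the single-defect factor `B₁` = the orbit of `δ 0` (`cls_lt_two_iff`); hence **`family_card`**:
`|family| = #(simple factors ≠ E) = |OrbitsA A|` (`|A| ≥ 3`), and **`card_eq_zero_of_card_eq_one`**: for `|A| = 1` there is no simple
factor other than `E` and no canonical square.  The number `|OrbitsA A|` itself is b17's Burnside count `card_orbitsA_mul`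
(`#orbits · 2|A| = Σ_{y ∈ A} (2^{|A/ℤy|} − 2)`; `29, 31, 1095` for `ℤ/9`, `(ℤ/3)², ℤ/15`; `(2^p − 2)/(2p)` for `ℤ/p`).  All [folklore].

## References
* [Pohlmann1968] H. Pohlmann, Algebraic cycles on abelian varieties of complex multiplication type, Ann. of Math. 88 (1968), Thm 1.
* [Milne1999] J. S. Milne, Lefschetz motives and the Tate conjecture, Compositio Math. 117 (1999), Prop. 2.1, p. 54.
-/

namespace Summit.HodgeConjecture.CorCM.Census.OddSliceFacesCount

open Finset
open Summit.HodgeConjecture.CorCM.Census.OddSliceFacesModel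
open Summit.HodgeConjecture.CorCM.Census.OddSliceFacesSquares
open Summit.HodgeConjecture.CorCM.Census.OddSliceFacesDescent
open Summit.HodgeConjecture.CorCM.Census.OddSliceFacesGenerate

section Main

variable (A : Type) [AddCommGroup A] [Fintype A] [DecidableEq A]

omit [DecidableEq A] in
/-- The representative of a simple factor is nonconstant. [folklore] -/
theorem rep_nonconst (ω : OddDegreeParityLaw.OrbitsA A) : ¬ ∀ y, rep A ω y = rep A ω 0 := by
  have h := one_le_cls A ω
  have hlt : Fintype.card A / 2 < Fintype.card A := Nat.div_lt_self (Fintype.card_pos_iff.mpr ⟨0⟩) one_lt_two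
  exact nonconst_of_wt A (by rw [wt_rep]; omega) (by rw [wt_rep]; omega)

omit [DecidableEq A] in
/-- The simple factor of the representative is the factor itself. [folklore] -/
theorem mk_rep (ω : OddDegreeParityLaw.OrbitsA A) :
    (Quotient.mk _ (⟨rep A ω, rep_nonconst A ω⟩ : OddDegreeParityLaw.Nonconst A) : OddDegreeParityLaw.OrbitsA A) = ω := by
  obtain ⟨g, hg⟩ := exists_tw_out_eq_rep A ω
  conv_rhs => rw [← Quotient.out_eq ω]
  refine Quotient.sound (AddAction.orbitRel_apply.mpr (AddAction.mem_orbit_iff.mpr ⟨(g.1, -g.2), ?_⟩))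
  apply Subtype.ext
  rw [vadd_val_eq_tw]
  show tw A (g.1, - -g.2) (Quotient.out ω).1 = rep A ω
  rw [neg_neg, ← hg]

omit [DecidableEq A] in
/-- `sqFace` is injective on simple factors. [folklore] -/
theorem sqFace_injective : Function.Injective (sqFace A) := by
  intro ω ω' h
  have h1 : rep A ω = rep A ω' := congrArg Prod.fst h
  rw [← mk_rep A ω, ← mk_rep A ω']
  exact congrArg _ (Subtype.ext h1)

/-- The number of canonical squares is the number of simple factors of defect class `≥ 2`. [folklore] -/
theorem squares_card : (squares A).card = (univ.filter fun ω : OddDegreeParityLaw.OrbitsA A => 2 ≤ cls A ω).card := by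
  unfold squares
  rw [Finset.card_image_of_injective _ (sqFace_injective A)]

/-- The closing face is not a canonical square (its first place is not a defect of its type; `|A| ≥ 3`). [folklore] -/
theorem sStar_not_mem_squares (h3 : 3 ≤ Fintype.card A) : sStar A ∉ squares A := by
  intro h
  obtain ⟨ω, hω, hωeq⟩ := Finset.mem_image.mp h
  have h2 : 2 ≤ wt A (rep A ω) := by rw [wt_rep]; exact (Finset.mem_filter.mp hω).2
  have hdef := (pick_spec A h2).2.1
  have h0 := sStar_fst_apply A h3
  have e1 : rep A ω = (sStar A).1 := congrArg Prod.fst hωeq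
  have e2 : (pick A (rep A ω)).1 = (sStar A).2.1 := congrArg (fun f => f.2.1) hωeq
  rw [e2, e1, h0] at hdef
  exact absurd hdef (by decide)

/-- The single-defect simple factor `B₁`: the orbit of `δ 0` (`|A| > 1`; for `|A| = 1` the type `δ 0` is constant and the definition
returns a junk orbit, never used). [folklore] -/
noncomputable def B1 (h1 : 1 < Fintype.card A) : OddDegreeParityLaw.OrbitsA A :=
  Quotient.mk _ ⟨δ A 0, nonconst_of_wt A (by rw [wt_delta]; exact Nat.one_pos) (by rw [wt_delta]; exact h1)⟩

/-- **Exactly one simple factor has defect class `< 2`**, namely `B₁` (`|A| > 1`). [folklore] -/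
theorem cls_lt_two_iff (h1 : 1 < Fintype.card A) (ω : OddDegreeParityLaw.OrbitsA A) : cls A ω < 2 ↔ ω = B1 A h1 := by
  constructor
  · intro h
    have hw1 : wt A (rep A ω) = 1 := by rw [wt_rep]; have := one_le_cls A ω; omega
    rcases eq_zero_or_eq_delta_of_wt_le_one A (le_of_eq hw1) with h0 | ⟨s, hs⟩
    · rw [h0, wt_zero] at hw1; exact absurd hw1 (by decide)
    · rw [← mk_rep A ω]
      unfold B1
      refine Quotient.sound (AddAction.orbitRel_apply.mpr (AddAction.mem_orbit_iff.mpr ⟨(0, s), ?_⟩))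
      apply Subtype.ext
      rw [vadd_val_eq_tw]
      show tw A (0, -s) (δ A 0) = rep A ω
      rw [hs]
      funext x
      simp only [tw, delta_apply, add_zero, add_neg_eq_zero]
  · rintro rfl
    unfold B1
    rw [cls_mk]
    show min (wt A (δ A 0)) (Fintype.card A - wt A (δ A 0)) < 2
    rw [wt_delta]
    omega

/-- **`|family| = #(simple factors ≠ E)`** (`|A| ≥ 3`). [folklore] -/
theorem family_card (h3 : 3 ≤ Fintype.card A) : (family A).card = Fintype.card (OddDegreeParityLaw.OrbitsA A) := by
  unfold family
  rw [Finset.card_union_of_disjoint (Finset.disjoint_singleton_right.mpr (sStar_not_mem_squares A h3)),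
    Finset.card_singleton, squares_card]
  have hneg : (univ.filter fun ω : OddDegreeParityLaw.OrbitsA A => ¬ 2 ≤ cls A ω).card = 1 := by
    rw [Finset.card_eq_one]
    refine ⟨B1 A (by omega), ?_⟩
    ext ω
    simp only [Finset.mem_filter, Finset.mem_univ, true_and, Finset.mem_singleton, not_le]
    exact cls_lt_two_iff A (by omega) ω
  have h := Finset.card_filter_add_card_filter_not (s := (univ : Finset (OddDegreeParityLaw.OrbitsA A)))
    (fun ω => 2 ≤ cls A ω)
  rw [hneg, Finset.card_univ] at h
  exact h

omit [DecidableEq A] in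
/-- For `|A| = 1` every type is constant: there is no simple factor other than `E`. [folklore] -/
theorem isEmpty_orbitsA_of_card_eq_one (h1 : Fintype.card A = 1) : IsEmpty (OddDegreeParityLaw.OrbitsA A) := by
  have hsub : Subsingleton A := Fintype.card_le_one_iff_subsingleton.mp h1.le
  have hN : IsEmpty (OddDegreeParityLaw.Nonconst A) :=
    ⟨fun φ => φ.2 fun y => by rw [Subsingleton.elim y 0]⟩
  exact ⟨fun ω => hN.false (Quotient.out ω)⟩

/-- **`|A| = 1`: no simple factor other than `E`, and no canonical square.** [folklore] -/
theorem card_eq_zero_of_card_eq_one (h1 : Fintype.card A = 1) :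
    Fintype.card (OddDegreeParityLaw.OrbitsA A) = 0 ∧ (squares A).card = 0 := by
  have hE := isEmpty_orbitsA_of_card_eq_one A h1
  refine ⟨Fintype.card_eq_zero, ?_⟩
  rw [squares_card, Finset.card_eq_zero, Finset.filter_eq_empty_iff]
  intro ω _
  exact hE.elim ω

end Main

end Summit.HodgeConjecture.CorCM.Census.OddSliceFacesCount
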